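import Summits.KontsevichZagierPeriods.Zeta5Search.RVFlatGaugeStructure
import Summits.KontsevichZagierPeriods.Zeta5Search.XSaveRhoValuation
import HarnessLib

/-!
# ζ(5) search — the flat `S₇`-gauge law beyond `m₁`, part 1: bookkeeping, the gauge exponents and `v_p(ρ)` beyond `m₁` (fam-rv gen-6)

HONEST FRAMING: systematic search; no irrationality claim unless certified.  Nothing in this file is an irrationality
statement.

Cell `pub-zeta5`, family-designer seat `pub-zeta5-fam-rv-g6` (Rhin–Viola permutation-group refinements, gen 6, 2026-08-21).
Staged at `HOME/pub-zeta5-fam-rv/gen6/lean/RVFlatGaugeBeyondM1Lemmas.lean`; proposed tree target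
`Summits/KontsevichZagierPeriods/Zeta5Search/RVFlatGaugeBeyondM1Lemmas.lean` (part 1 of 2; part 2 = `RVFlatGaugeBeyondM1.lean`,
which carries the theorems and the full account).  Imports ONLY accepted tree files; `lean check` rc 0, 0 `sorry`.

CONTENT (all PROVED, elementary): §1 every one of the 28 forms `b_i`, `b₀−b_i−b_k` is `≤ m₁(b)`, hence `b₀ ≤ 3m₁`, `m₅ ≤ m₁`,
`d ≤ 3m₁` (via gen-4's `dOf_le_three_mul_m5`); §2 for a prime `p > m₁(b)`: `e_D(b,p) = 0`, `e_D♭(b,p) = [2p ≤ d(b)]`,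
`Σ⌊(b₀−b_i−b_k)/p⌋ = 0`, refund `= [p ≤ d(b)]`; §3 `v_p(ρ(b)) = −⌊d(b)/p⌋` for every prime `p > m₁(b)`, `p ≠ 2`, in EVERY
labelling `σ ∈ S₇` (Legendre on `1/d!`; the other twenty factorials of `ρ` are `p`-adic units) — the permutation group gives no
saving beyond `m₁` (Brown–Zudilin's `ν_p = 0` there).  References and the honest VALUE / NOT-PROVED account: part 2.
-/

namespace Summit.KontsevichZagierPeriods.Zeta5Search.RVFlatGauge

open Finset
open Summit.KontsevichZagierPeriods.Zeta5Search.CasoratianValuation (casoratian shift InPolytope pairFloors refund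
  CasoratianValuationLaw)
open Summit.KontsevichZagierPeriods.Zeta5Search.WedgeDictionary (dOf Epairs)
open Summit.KontsevichZagierPeriods.Zeta5Search.SymmetricGauge

/-! ### §1 Bookkeeping: every one of the 28 forms is `≤ m₁`; `b₀ ≤ 3m₁`, `d ≤ 3m₁` -/

/-- `x ≤ l.foldr max 0` for every member `x` of `l`. -/
theorem le_foldr_max_of_mem {l : List ℤ} {x : ℤ} (hx : x ∈ l) : x ≤ l.foldr max 0 := by
  induction l with
  | nil => simp at hx
  | cons a t ih =>
    simp only [List.foldr_cons]
    rcases List.mem_cons.1 hx with rfl | h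
    · exact le_max_left _ _
    · exact le_trans (ih h) (le_max_right _ _)

/-- `0 ≤ l.foldr max 0`. -/
theorem foldr_max_nonneg (l : List ℤ) : 0 ≤ l.foldr max 0 := by
  induction l with
  | nil => simp
  | cons a t ih => simp only [List.foldr_cons]; exact le_trans ih (le_max_right _ _)

/-- Every one of the 28 forms is `≤ m₁`. -/
theorem le_m1_of_mem {b : ℕ → ℤ} {x : ℤ} (hx : x ∈ forms28 b) : x ≤ m1 b := le_foldr_max_of_mem hx

/-- `0 ≤ m₁`. -/
theorem m1_nonneg (b : ℕ → ℤ) : 0 ≤ m1 b := foldr_max_nonneg _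

/-- The seven lower parameters are among the 28 forms. -/
theorem single_mem_forms28 (b : ℕ → ℤ) {i : ℕ} (hi : i < 7) : b (i + 1) ∈ forms28 b := by
  unfold forms28
  refine List.mem_append.2 (Or.inl ?_)
  exact List.mem_map.2 ⟨i, List.mem_range.2 hi, rfl⟩

/-- The 21 pair complements are among the 28 forms. -/
theorem pair_mem_forms28 (b : ℕ → ℤ) {i k : ℕ} (hi : i < 7) (hk : k < 7) (hik : i < k) :
    b 0 - b (i + 1) - b (k + 1) ∈ forms28 b := by
  unfold forms28
  refine List.mem_append.2 (Or.inr ?_)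
  refine List.mem_flatMap.2 ⟨i, List.mem_range.2 hi, ?_⟩
  refine List.mem_map.2 ⟨k, ?_, rfl⟩
  exact List.mem_filter.2 ⟨List.mem_range.2 hk, by simpa using hik⟩

/-- `b_{i+1} ≤ m₁`. -/
theorem single_le_m1 (b : ℕ → ℤ) {i : ℕ} (hi : i < 7) : b (i + 1) ≤ m1 b :=
  le_m1_of_mem (single_mem_forms28 b hi)

/-- `b₀ − b_{i+1} − b_{k+1} ≤ m₁` for `i ≠ k`. -/
theorem pair_le_m1 (b : ℕ → ℤ) {i k : ℕ} (hi : i < 7) (hk : k < 7) (hik : i ≠ k) :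
    b 0 - b (i + 1) - b (k + 1) ≤ m1 b := by
  rcases Nat.lt_or_gt_of_ne hik with h | h
  · exact le_m1_of_mem (pair_mem_forms28 b hi hk h)
  · rw [show b 0 - b (i + 1) - b (k + 1) = b 0 - b (k + 1) - b (i + 1) by ring]
    exact le_m1_of_mem (pair_mem_forms28 b hk hi h)

/-- `b₀ ≤ 3m₁` as soon as `b₁ + b₂ ≤ b₀`-type positivity is available: here from `b₀ − b₁ − b₂, b₁, b₂ ≤ m₁`. -/
theorem b0_le_three_mul_m1 (b : ℕ → ℤ) : b 0 ≤ 3 * m1 b := by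
  have h1 := single_le_m1 b (i := 0) (by norm_num)
  have h2 := single_le_m1 b (i := 1) (by norm_num)
  have h12 := pair_le_m1 b (i := 0) (k := 1) (by norm_num) (by norm_num) (by norm_num)
  simp only [zero_add, Nat.reduceAdd] at h1 h2 h12
  omega

/-- `m₅ ≤ m₁` (the fifth largest form is one of the 28). -/
theorem m5_le_m1 (b : ℕ → ℤ) : m5 b ≤ m1 b := by
  unfold m5
  set s := (forms28 b).insertionSort (· ≥ ·) with hs
  have hlen : s.length = 28 := by rw [hs, List.length_insertionSort, forms28_eq]; rfl
  have h4 : 4 < s.length := by omega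
  rw [List.getD_eq_getElem s 0 h4]
  have hmem : s[4] ∈ forms28 b := (List.perm_insertionSort (· ≥ ·) (forms28 b)).subset (List.getElem_mem h4)
  exact le_m1_of_mem hmem

/-- `d ≤ 3m₁` on the polytope (`d ≤ 3m₅ ≤ 3m₁`). -/
theorem dOf_le_three_mul_m1 {b : ℕ → ℤ} (hb : InPolytope b) : dOf b ≤ 3 * m1 b :=
  le_trans (dOf_le_three_mul_m5 hb) (by have := m5_le_m1 b; omega)

/-- `0 ≤ d` on the polytope. -/
theorem dOf_nonneg {b : ℕ → ℤ} (hb : InPolytope b) : 0 ≤ dOf b := by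
  have := hb.2.2; unfold dOf; omega

/-! ### §2 Beyond `m₁`: `e_D = 0`, `e_D♭ = [2p ≤ d]`, `pairFloors = 0`, `refund = [p ≤ d]` -/

/-- Beyond `m₁` Brown–Zudilin's `D = d_{m₁}⋯d_{m₅}` carries no `p`: `e_D(b,p) = 0` for `p > m₁(b)`. -/
theorem eD_eq_zero_of_m1_lt (b : ℕ → ℤ) {p : ℕ} (hm : m1 b < p) : eD b p = 0 := by
  unfold eD
  apply List.sum_eq_zero
  intro x hx
  obtain ⟨m, hm', rfl⟩ := List.mem_map.1 hx
  have hmem : m ∈ forms28 b :=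
    (List.perm_insertionSort (· ≥ ·) (forms28 b)).subset (List.mem_of_mem_take hm')
  have hle := le_m1_of_mem hmem
  have h0 := m1_nonneg b
  have hlt : m.toNat < p := by omega
  simp [Nat.log_of_lt hlt]

/-- Beyond `m₁` the flat exponent is the indicator of `2p ≤ d`: `e_D♭(b,p) = [2p ≤ d(b)]` (`p ≥ 3`, `b` in the polytope). -/
theorem eDflat_eq_of_m1_lt {b : ℕ → ℤ} (hb : InPolytope b) {p : ℕ} (hp3 : 3 ≤ p) (hm : m1 b < p) :
    eDflat b p = if 2 * (p : ℤ) ≤ dOf b then 1 else 0 := by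
  have hd0 := dOf_nonneg hb
  have hd3 := dOf_le_three_mul_m1 hb
  have hm5 := m5_le_m1 b
  have hm50 := m5_nonneg hb
  have hlog5 : Nat.log p (m5 b).toNat = 0 := Nat.log_of_lt (by omega)
  have hp0 : (0 : ℤ) < p := by exact_mod_cast (show 0 < p by omega)
  unfold eDflat
  rw [eD_eq_zero_of_m1_lt b hm, hlog5]
  unfold m5flat
  split_ifs with h2
  · -- `p ≤ d/2 < p²`
    have hle : (p : ℤ) ≤ dOf b / 2 := by omega
    have hmax : max (m5 b) (dOf b / 2) = dOf b / 2 := max_eq_right (by omega)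
    rw [hmax]
    have hlt : dOf b / 2 < (p : ℤ) * p := by
      have h1 : dOf b / 2 ≤ dOf b := Int.ediv_le_self 2 hd0
      have h2 : (3 : ℤ) * p ≤ (p : ℤ) * p := by nlinarith
      omega
    have h1 : Nat.log p (dOf b / 2).toNat = 1 := by
      rw [Nat.log_eq_one_iff']
      constructor
      · have : ((p : ℕ) : ℤ) ≤ ((dOf b / 2).toNat : ℤ) := by rw [Int.toNat_of_nonneg (by omega)]; exact hle
        exact_mod_cast this
      · have : ((dOf b / 2).toNat : ℤ) < (p * p : ℕ) := by
          rw [Int.toNat_of_nonneg (by omega)]; push_cast; exact hlt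
        exact_mod_cast this
    rw [h1]; norm_num
  · have hlt : (max (m5 b) (dOf b / 2)).toNat < p := by
      have : max (m5 b) (dOf b / 2) < p := max_lt (by omega) (by omega)
      omega
    rw [Nat.log_of_lt hlt]; norm_num

/-- Beyond `m₁` no pair block contains a multiple of `p`: `Σ_{i<k} ⌊(b₀−b_i−b_k)/p⌋ = 0`. -/
theorem pairFloors_eq_zero_of_m1_lt {b : ℕ → ℤ} (hb : InPolytope b) {p : ℕ} (hm : m1 b < p) :
    pairFloors b p = 0 := by
  unfold pairFloors
  refine sum_eq_zero fun i hi => sum_eq_zero fun k hk => ?_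
  split_ifs with hik
  · have hi7 := mem_range.1 hi
    have hk7 := mem_range.1 hk
    have hle := pair_le_m1 b hi7 hk7 (ne_of_lt hik)
    have h2i := hb.2.1 i hi
    have h2k := hb.2.1 k hk
    exact Int.ediv_eq_zero_of_lt (by omega) (by omega)
  · rfl

/-- Beyond `m₁` (indeed always) the refund is the indicator of `p ≤ d`. -/
theorem refund_eq_of_pos {b : ℕ → ℤ} (hb : InPolytope b) {p : ℕ} (hp : 0 < p) :
    refund b p = if (p : ℤ) ≤ dOf b then 1 else 0 := by
  have hd0 := dOf_nonneg hb
  have hp0 : (0 : ℤ) < p := by exact_mod_cast hp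
  unfold refund
  split_ifs with h
  · exact min_eq_left ((Int.le_ediv_iff_mul_le hp0).2 (by simpa using h))
  · rw [Int.ediv_eq_zero_of_lt hd0 (by omega)]; norm_num


/-! ### §3 Beyond `m₁`: `v_p(ρ(b)) = −⌊d/p⌋` in EVERY labelling -/

/-- The fifteen `E`-pairs have distinct entries in `[1,7]`. -/
theorem epairs_range : ∀ jk ∈ Epairs, 1 ≤ jk.1 ∧ jk.1 ≤ 7 ∧ 1 ≤ jk.2 ∧ jk.2 ≤ 7 ∧ jk.1 ≠ jk.2 := by decide

/-- `b_j ≤ m₁` for `1 ≤ j ≤ 7` (1-based form of `single_le_m1`). -/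
theorem single_le_m1' (b : ℕ → ℤ) {j : ℕ} (hj : 1 ≤ j) (hj7 : j ≤ 7) : b j ≤ m1 b := by
  obtain ⟨i, rfl⟩ : ∃ i, j = i + 1 := ⟨j - 1, by omega⟩
  exact single_le_m1 b (by omega)

/-- `b₀ − b_j − b_k ≤ m₁` for distinct `j, k ∈ [1,7]` (1-based form of `pair_le_m1`). -/
theorem pair_le_m1' (b : ℕ → ℤ) {j k : ℕ} (hj : 1 ≤ j) (hj7 : j ≤ 7) (hk : 1 ≤ k) (hk7 : k ≤ 7) (hjk : j ≠ k) :
    b 0 - b j - b k ≤ m1 b := by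
  obtain ⟨i, rfl⟩ : ∃ i, j = i + 1 := ⟨j - 1, by omega⟩
  obtain ⟨i', rfl⟩ : ∃ i', k = i' + 1 := ⟨k - 1, by omega⟩
  exact pair_le_m1 b (by omega) (by omega) (by omega)

/-- Legendre below `p²`: `v_p(n!) = ⌊n/p⌋` for `n < p²`. -/
theorem padicValNat_factorial_of_lt_sq {p n : ℕ} [hp : Fact p.Prime] (h : n < p ^ 2) :
    padicValNat p n.factorial = n / p := by
  have hlog : Nat.log p n < 2 := by
    rcases Nat.eq_zero_or_pos n with rfl | hn
    · simp
    · exact (Nat.log_lt_iff_lt_pow hp.out.one_lt hn.ne').2 h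
  rw [padicValNat_factorial (b := 2) hlog]
  simp

/-- **`v_p(ρ(b)) = −⌊d(b)/p⌋` for every prime `p > m₁(b)`, `p ≠ 2`** (`b` in the polytope): beyond `m₁` all twenty
factorials `(b₀−b_j−b_k)!`, `(j,k) ∈ E`, and `b₁!, b₄!, b₅!, b₆!, b₇!` of gen-1's closed scalar are `p`-adic units and only
`1/d!` carries `p`, to the exponent `⌊d/p⌋` (Legendre; `d ≤ 3m₁ < 3p ≤ p²`).  Same computation as the census's
`XSave.padicValRat_rhoOf` (a-side), here for an arbitrary dual vector. -/
theorem padicValRat_rhoB_of_m1_lt {b : ℕ → ℤ} (hb : InPolytope b) {p : ℕ} (hp : p.Prime) (hp2 : p ≠ 2)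
    (hm : m1 b < p) : padicValRat p (rhoB b) = -(dOf b / p) := by
  haveI : Fact p.Prime := ⟨hp⟩
  have hd0 := dOf_nonneg hb
  have hd3 := dOf_le_three_mul_m1 hb
  have hm0 := m1_nonneg b
  -- the numerator and the `d`-free denominator as natural numbers
  set N : ℕ := (Epairs.map fun jk => (b 0 - b jk.1 - b jk.2).toNat.factorial).prod with hN
  set M : ℕ := (([1, 4, 5, 6, 7] : List ℕ).map fun j => (b j).toNat.factorial).prod with hM
  set D : ℕ := (dOf b).toNat.factorial with hD
  have hrho : rhoB b = ((-1 : ℚ) ^ (∑ j ∈ range 7, b (j + 1)).toNat * (N : ℚ)) / ((4 * M : ℕ) * (D : ℚ)) := by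
    unfold rhoB
    simp only [hN, hM, hD, Epairs, List.map, List.prod_cons, List.prod_nil]
    push_cast
    ring
  have hNpos : 0 < N := by
    rw [hN]; exact List.prod_pos fun x hx => by
      obtain ⟨jk, -, rfl⟩ := List.mem_map.1 hx; exact Nat.factorial_pos _
  have hMpos : 0 < M := by
    rw [hM]; exact List.prod_pos fun x hx => by
      obtain ⟨j, -, rfl⟩ := List.mem_map.1 hx; exact Nat.factorial_pos _
  have hDpos : 0 < D := Nat.factorial_pos _
  -- valuations of the pieces
  have vN : padicValNat p N = 0 := by
    rw [hN]
    refine XSave.padicValNat_list_prod_eq_zero hp _ fun x hx => ?_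
    obtain ⟨jk, hjk, rfl⟩ := List.mem_map.1 hx
    obtain ⟨h1, h2, h3, h4, h5⟩ := epairs_range jk hjk
    have hle := pair_le_m1' b h1 h2 h3 h4 h5
    rw [hp.dvd_factorial]; omega
  have vM : padicValNat p (4 * M) = 0 := by
    rw [show 4 * M = ([4] ++ (([1, 4, 5, 6, 7] : List ℕ).map fun j => (b j).toNat.factorial)).prod by
      rw [List.prod_append, hM]; simp]
    refine XSave.padicValNat_list_prod_eq_zero hp _ fun x hx => ?_
    rcases List.mem_append.1 hx with h4 | hx
    · simp only [List.mem_singleton] at h4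
      subst h4
      intro h
      have h' : p ∣ 2 ^ 2 := by norm_num at h ⊢; exact h
      have := (Nat.prime_dvd_prime_iff_eq hp Nat.prime_two).1 (hp.dvd_of_dvd_pow h')
      exact hp2 this
    · obtain ⟨j, hj, rfl⟩ := List.mem_map.1 hx
      have hj' : 1 ≤ j ∧ j ≤ 7 := by simp only [List.mem_cons, List.not_mem_nil, or_false] at hj; omega
      have hle := single_le_m1' b hj'.1 hj'.2
      rw [hp.dvd_factorial]; omega
  have vD : padicValNat p D = (dOf b).toNat / p := by
    rw [hD]
    refine padicValNat_factorial_of_lt_sq ?_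
    have h1 : (dOf b).toNat < 3 * p := by omega
    have h3 : 3 ≤ p := by have := hp.two_le; omega
    have h2 : 3 * p ≤ p ^ 2 := by rw [sq]; exact Nat.mul_le_mul_right p h3
    omega
  -- assemble
  have hNq : (N : ℚ) ≠ 0 := by exact_mod_cast hNpos.ne'
  have hsq : ((-1 : ℚ)) ^ (∑ j ∈ range 7, b (j + 1)).toNat ≠ 0 := pow_ne_zero _ (by norm_num)
  have hnum : ((-1 : ℚ)) ^ (∑ j ∈ range 7, b (j + 1)).toNat * (N : ℚ) ≠ 0 := mul_ne_zero hsq hNq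
  have h4M : ((4 * M : ℕ) : ℚ) ≠ 0 := by exact_mod_cast (show 4 * M ≠ 0 by omega)
  have hDq : (D : ℚ) ≠ 0 := by exact_mod_cast hDpos.ne'
  have hden : ((4 * M : ℕ) : ℚ) * (D : ℚ) ≠ 0 := mul_ne_zero h4M hDq
  have v1 : padicValRat p ((-1 : ℚ) ^ (∑ j ∈ range 7, b (j + 1)).toNat) = 0 := by
    rcases neg_one_pow_eq_or ℚ ((∑ j ∈ range 7, b (j + 1)).toNat) with h | h <;>
      simp [h, padicValRat.neg]
  rw [hrho, padicValRat.div hnum hden, padicValRat.mul hsq hNq, padicValRat.mul h4M hDq, v1,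
    padicValRat.of_nat, padicValRat.of_nat, padicValRat.of_nat, vN, vM, vD, Int.natCast_div,
    Int.toNat_of_nonneg hd0]
  push_cast
  ring

/-- `ρ(b) ≠ 0` (a signed quotient of factorials). -/
theorem rhoB_ne_zero (b : ℕ → ℤ) : rhoB b ≠ 0 := by
  unfold rhoB
  refine div_ne_zero (mul_ne_zero (pow_ne_zero _ (by norm_num)) ?_) (mul_ne_zero (mul_ne_zero (by norm_num) ?_) ?_)
  · exact List.prod_ne_zero fun h => by
      obtain ⟨jk, -, hjk⟩ := List.mem_map.1 h
      exact absurd hjk.symm (by exact_mod_cast (Nat.factorial_pos _).ne)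
  · exact List.prod_ne_zero fun h => by
      obtain ⟨j, -, hj⟩ := List.mem_map.1 h
      exact absurd hj.symm (by exact_mod_cast (Nat.factorial_pos _).ne)
  · exact_mod_cast (Nat.factorial_pos _).ne'

/-- **No permutation-group saving beyond `m₁`:** `v_p(ρ(σ•b)) = v_p(ρ(b))` for every `σ ∈ S₇` and every prime
`p > m₁(b)`, `p ≠ 2` — Brown–Zudilin's `ν_p = max_σ (v_p ρ(b) − v_p ρ(σ•b))` vanishes there (their `Φₙ` has no prime
factor beyond `m₁n`), so the gauge bound is labelling-independent beyond `m₁`. -/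
theorem padicValRat_rhoB_perm_of_m1_lt {b : ℕ → ℤ} (hb : InPolytope b) (σ : Equiv.Perm (Fin 7)) {p : ℕ}
    (hp : p.Prime) (hp2 : p ≠ 2) (hm : m1 b < p) :
    padicValRat p (rhoB (permLower σ b)) = padicValRat p (rhoB b) := by
  obtain ⟨hP, hd, hm1, -, -⟩ := gaugeDataPermInvariant_holds b σ
  rw [padicValRat_rhoB_of_m1_lt (hP hb) hp hp2 (by rw [hm1]; exact hm), padicValRat_rhoB_of_m1_lt hb hp hp2 hm, hd]

end Summit.KontsevichZagierPeriods.Zeta5Search.RVFlatGauge
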